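import Mathlib
import HarnessLib
import Literature.LinearAlgebra.Matrix.CollatzWielandtUpperBound
import Summits.HubbardSuperconductivity.HubbardSuperconductivity.Theorems.SoloBlindReciprocalCharge

/-!
# Every sign-free floor constant dominates every hop eigenvalue; the Perron scheme is tight
# (Proposition 43, λ_max half — generation 72)

Solo-blind programme `HubbardSuperconductivity`, generation 72: the spectral ("Collatz–Wielandt
read backwards") half of the ENDPOINT OF EVERY SIGN-FREE FLOOR (Proposition 43 of the obstruction
paper, §5.20(19)), completing in kernel form what `SoloBlindReciprocalCharge` (generation 60) left
as a docstring remark.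

Setting (as in `SoloBlindReciprocalCharge`). `V` a finite type, `R` a symmetric decidable relation
on `V` (the *hops*; in the application `V` = `E`-hole configurations of the `L × L` torus and `R` =
one hole hops to a free neighbouring site), a *weight scheme* `u : V → V → ℝ` that is AM–GM
admissible on hops (`u v w ≥ 0`, `u v w · u w v ≥ 1` whenever `R v w`), and the *charge*
`C_u(v) = Σ_{w : R v w} u v w`.  The *hop operator* is `(Aφ)(v) = Σ_{w : R v w} φ w`, i.e. the
`0/1` adjacency matrix `Matrix.of (fun v w => if R v w then 1 else 0)` of the hop graph.

* `exists_eigenvalue_le_charge` — if `Aφ = μφ` with `φ ≢ 0` (sum form) then some `v` in the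
  support of `φ` has `μ ≤ C_u(v)`: EVERY real eigenvalue of the hop graph, in particular its
  largest one `λ_max`, is a lower bound for the floor constant `max_v C_u(v)` of EVERY admissible
  scheme (from `ReciprocalCharge.exists_charge_ge`: `⟨φ,Aφ⟩ = μ Σφ²`).
* `exists_eigenvalue_le_charge_of_mulVec` — the same with the eigen-equation in `Matrix.mulVec`
  form.
* `perronScheme_nonneg`, `perronScheme_reciprocal`, `perronScheme_charge_eq` — TIGHTNESS: a
  positive solution `φ ≫ 0` of `Aφ = μφ` yields the admissible scheme `u v w = φ w / φ v`
  (`u v w · u w v = 1`) whose charge is CONSTANT, `C_u(v) = μ` for every `v`.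
* `abs_eigenvalue_le_of_pos_eigenvector` — with such a `φ`, every real eigenpair `Aψ = νψ`,
  `ψ ≢ 0`, has `|ν| ≤ μ` (the Collatz–Wielandt upper bound of
  `Literature.LinearAlgebra.Matrix.norm_eigenvalue_le_of_dominated_of_mulVec_le` with `x = φ`,
  `β = μ`), so `μ` is the spectral radius `λ_max` of the hop graph.
* `perron_endpoint` — the three statements packaged: given a positive eigenvector with eigenvalue
  `μ`, (a) every admissible scheme has some charge `≥ μ`, (b) some admissible scheme has all
  charges `= μ`, (c) `μ = λ_max`; i.e. `min_u max_v C_u(v) = λ_max(A)`.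

Reading (paper §5.20(19), Proposition 43: `max_s C_u(s) ≥ λ_max(A_E) ≥ 4E(L²−E)/(L²−1)`).
The mean-degree inequality `max_s C_u(s) ≥ 4E(L²−E)/(L²−1)` is kernel since generation 60
(`SoloBlindSignFreeFloorEndpoint`).  This file makes the sharper `λ_max` statement kernel as well:
no sign-free kinetic floor `re ⟨ψ,Tψ⟩ ≥ −t·max_s C_u(s)‖ψ‖²` obtained by reciprocal AM–GM on hole
hops can have its constant below the hard-core-boson ground-state value `t·λ_max(A_E)` of the same
hop graph, and the Perron scheme attains it.  What remains OUTSIDE the kernel is only the EXISTENCE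
of a positive eigenvector for the connected hop graph (Perron–Frobenius, not in Mathlib), which is
why (b), (c) are stated conditionally on `φ ≫ 0`; (a) is unconditional.

References: this work (obstruction paper §5.20(19)); the bound in (c) is Collatz 1942 / Wielandt
1950 as typed in `Literature/LinearAlgebra/Matrix/CollatzWielandtUpperBound.lean`
[BermanPlemmons1994, Ch. 2, Thm. (1.11)].
-/

namespace Summit.HubbardSuperconductivity.HubbardSuperconductivity.Theorems.ChargePerron

open Finset Matrix
open Summit.HubbardSuperconductivity.HubbardSuperconductivity.Theorems.ReciprocalCharge

variable {V : Type*} [Fintype V] (R : V → V → Prop) [DecidableRel R]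

/-! ### Every eigenvalue is dominated by some charge -/

/-- The adjacency form against an eigenvector: if `Σ_{w : R v w} φ w = μ φ v` for all `v` then
`Σ_v Σ_{w : R v w} φ v φ w = μ Σ_v φ v²`. [this work] -/
theorem adjForm_eq_of_eigen {μ : ℝ} {φ : V → ℝ}
    (heig : ∀ v, (∑ w, if R v w then φ w else 0) = μ * φ v) :
    (∑ v, ∑ w, if R v w then φ v * φ w else 0) = μ * ∑ v, φ v ^ 2 := by
  have h1 : ∀ v, (∑ w, if R v w then φ v * φ w else 0) = φ v * ∑ w, if R v w then φ w else 0 := by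
    intro v
    rw [Finset.mul_sum]
    refine Finset.sum_congr rfl fun w _ => ?_
    split_ifs <;> simp
  simp_rw [h1, heig]
  rw [Finset.mul_sum]
  exact Finset.sum_congr rfl fun v _ => by ring

/-- **Every hop eigenvalue is at most some charge** (Proposition 43, `λ_max` half, sum form).
For a symmetric relation `R`, an AM–GM admissible scheme `u` (`u ≥ 0`, `u v w · u w v ≥ 1` on
hops) and every real solution of `Σ_{w : R v w} φ w = μ φ v` (all `v`) with `φ ≢ 0`, some `v`
with `φ v ≠ 0` has `μ ≤ C_u(v) = Σ_{w : R v w} u v w`.  In particular `λ_max(A) ≤ max_v C_u(v)`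
for every admissible `u`. [this work] -/
theorem exists_eigenvalue_le_charge (hR : ∀ v w, R v w → R w v) (u : V → V → ℝ)
    (hu : ∀ v w, R v w → 0 ≤ u v w) (huu : ∀ v w, R v w → 1 ≤ u v w * u w v)
    {μ : ℝ} {φ : V → ℝ} (hφ : ∃ v, φ v ≠ 0)
    (heig : ∀ v, (∑ w, if R v w then φ w else 0) = μ * φ v) :
    ∃ v, φ v ≠ 0 ∧ μ ≤ ∑ w, if R v w then u v w else 0 := by
  obtain ⟨v, hv, hle⟩ := exists_charge_ge R hR u hu huu φ hφ
  refine ⟨v, hv, ?_⟩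
  rw [adjForm_eq_of_eigen R heig] at hle
  have hTpos : 0 < ∑ x, φ x ^ 2 :=
    lt_of_lt_of_le (by positivity : (0 : ℝ) < φ v ^ 2)
      (Finset.single_le_sum (fun x _ => sq_nonneg (φ x)) (Finset.mem_univ v))
  exact le_of_mul_le_mul_right hle hTpos

/-- The hop operator in `Matrix.mulVec` form is the sum form. -/
theorem hopMatrix_mulVec_apply (φ : V → ℝ) (v : V) :
    ((Matrix.of fun v w : V => if R v w then (1 : ℝ) else 0) *ᵥ φ) v =
      ∑ w, if R v w then φ w else 0 := by
  simp only [mulVec, dotProduct, Matrix.of_apply]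
  refine Finset.sum_congr rfl fun w _ => ?_
  split_ifs <;> simp

/-- **Every hop eigenvalue is at most some charge**, `Matrix.mulVec` form: if
`A φ = μ • φ` for the `0/1` hop matrix `A = Matrix.of (fun v w => if R v w then 1 else 0)` and
`φ ≠ 0`, then some `v` with `φ v ≠ 0` has `μ ≤ C_u(v)`. [this work] -/
theorem exists_eigenvalue_le_charge_of_mulVec (hR : ∀ v w, R v w → R w v) (u : V → V → ℝ)
    (hu : ∀ v w, R v w → 0 ≤ u v w) (huu : ∀ v w, R v w → 1 ≤ u v w * u w v)
    {μ : ℝ} {φ : V → ℝ} (hφ : φ ≠ 0)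
    (heig : (Matrix.of fun v w : V => if R v w then (1 : ℝ) else 0) *ᵥ φ = μ • φ) :
    ∃ v, φ v ≠ 0 ∧ μ ≤ ∑ w, if R v w then u v w else 0 := by
  refine exists_eigenvalue_le_charge R hR u hu huu (Function.ne_iff.1 hφ) fun v => ?_
  rw [← hopMatrix_mulVec_apply R φ v, heig, Pi.smul_apply, smul_eq_mul]

/-! ### Tightness: the Perron scheme has constant charge -/

omit [Fintype V] in
/-- The Perron scheme `u v w = φ w / φ v` of a positive vector is nonnegative. [this work] -/
theorem perronScheme_nonneg {φ : V → ℝ} (hpos : ∀ v, 0 < φ v) (v w : V) :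
    0 ≤ φ w / φ v :=
  div_nonneg (hpos w).le (hpos v).le

omit [Fintype V] in
/-- The Perron scheme is reciprocal: `(φ w / φ v) · (φ v / φ w) = 1`, so it is AM–GM admissible.
[this work] -/
theorem perronScheme_reciprocal {φ : V → ℝ} (hpos : ∀ v, 0 < φ v) (v w : V) :
    1 ≤ φ w / φ v * (φ v / φ w) := by
  rw [div_mul_div_comm, mul_comm (φ w) (φ v),
    div_self (mul_ne_zero (hpos v).ne' (hpos w).ne')]

/-- **Tightness of the Perron scheme.** If `φ ≫ 0` solves `Σ_{w : R v w} φ w = μ φ v` for all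
`v`, then the scheme `u v w = φ w / φ v` has constant charge `C_u(v) = μ`. [this work] -/
theorem perronScheme_charge_eq {μ : ℝ} {φ : V → ℝ} (hpos : ∀ v, 0 < φ v)
    (heig : ∀ v, (∑ w, if R v w then φ w else 0) = μ * φ v) (v : V) :
    (∑ w, if R v w then φ w / φ v else 0) = μ := by
  have h1 : (∑ w, if R v w then φ w / φ v else 0) = (∑ w, if R v w then φ w else 0) / φ v := by
    rw [Finset.sum_div]
    refine Finset.sum_congr rfl fun w _ => ?_
    split_ifs <;> simp
  rw [h1, heig, mul_div_assoc, div_self (hpos v).ne', mul_one]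

/-! ### The positive eigenvalue is the spectral radius (Collatz–Wielandt) -/

/-- **A positive eigenvector carries the top eigenvalue.** If `φ ≫ 0` solves the hop
eigen-equation with eigenvalue `μ`, then every real eigenpair `Σ_{w : R v w} ψ w = ν ψ v`,
`ψ ≢ 0`, has `|ν| ≤ μ` (Collatz–Wielandt upper bound with `x = φ`, `β = μ`; the hop matrix is
its own nonnegative dominant). [cite: BermanPlemmons1994, Ch. 2, Thm. (1.11); this work] -/
theorem abs_eigenvalue_le_of_pos_eigenvector {μ : ℝ} {φ : V → ℝ} (hpos : ∀ v, 0 < φ v)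
    (heig : ∀ v, (∑ w, if R v w then φ w else 0) = μ * φ v)
    {ν : ℝ} {ψ : V → ℝ} (hψ : ∃ v, ψ v ≠ 0)
    (hν : ∀ v, (∑ w, if R v w then ψ w else 0) = ν * ψ v) : |ν| ≤ μ := by
  set A : Matrix V V ℝ := Matrix.of fun v w : V => if R v w then (1 : ℝ) else 0 with hA
  have hdom : ∀ i j, ‖A i j‖ ≤ A i j := by
    intro i j
    simp only [hA, Matrix.of_apply]
    split_ifs <;> simp
  have hβ : ∀ i, (A *ᵥ φ) i ≤ μ * φ i := fun i => by
    rw [hA, hopMatrix_mulVec_apply R φ i, heig i]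
  have hψ' : ψ ≠ 0 := by
    obtain ⟨v, hv⟩ := hψ
    exact Function.ne_iff.2 ⟨v, hv⟩
  have hνeq : A *ᵥ ψ = ν • ψ := by
    funext v
    rw [hA, hopMatrix_mulVec_apply R ψ v, hν v, Pi.smul_apply, smul_eq_mul]
  have h := Literature.LinearAlgebra.Matrix.norm_eigenvalue_le_of_dominated_of_mulVec_le
    hdom hpos hβ hψ' hνeq
  simpa [Real.norm_eq_abs] using h

/-! ### The endpoint packaged -/

/-- **Perron endpoint of the sign-free floors** (Proposition 43, `λ_max` half with tightness).
Let `R` be symmetric on a nonempty finite type and let `φ ≫ 0` solve the hop eigen-equation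
`Σ_{w : R v w} φ w = μ φ v` (for the connected hole-hop graph such a `φ` exists by
Perron–Frobenius and `μ = λ_max(A_E)`; that existence is the only input not typed here).  Then
(a) EVERY AM–GM admissible scheme `u` has some charge `C_u(v) ≥ μ`;
(b) SOME admissible scheme (the Perron scheme `φ w / φ v`) has ALL charges equal to `μ`;
(c) every real hop eigenvalue `ν` has `|ν| ≤ μ`.
Hence `min_u max_v C_u(v) = μ = λ_max`: the best constant of any sign-free AM–GM floor is exactly
the hard-core-boson value. [this work] -/
theorem perron_endpoint [Nonempty V] (hR : ∀ v w, R v w → R w v) {μ : ℝ} {φ : V → ℝ}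
    (hpos : ∀ v, 0 < φ v) (heig : ∀ v, (∑ w, if R v w then φ w else 0) = μ * φ v) :
    (∀ u : V → V → ℝ, (∀ v w, R v w → 0 ≤ u v w) → (∀ v w, R v w → 1 ≤ u v w * u w v) →
        ∃ v, μ ≤ ∑ w, if R v w then u v w else 0) ∧
      (∃ u : V → V → ℝ, (∀ v w, 0 ≤ u v w) ∧ (∀ v w, 1 ≤ u v w * u w v) ∧
        ∀ v, (∑ w, if R v w then u v w else 0) = μ) ∧
      (∀ (ν : ℝ) (ψ : V → ℝ), (∃ v, ψ v ≠ 0) →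
        (∀ v, (∑ w, if R v w then ψ w else 0) = ν * ψ v) → |ν| ≤ μ) := by
  refine ⟨fun u hu huu => ?_, ?_, fun ν ψ hψ hν => abs_eigenvalue_le_of_pos_eigenvector R hpos heig hψ hν⟩
  · obtain ⟨v₀⟩ := (inferInstance : Nonempty V)
    obtain ⟨v, -, hv⟩ :=
      exists_eigenvalue_le_charge R hR u hu huu ⟨v₀, (hpos v₀).ne'⟩ heig
    exact ⟨v, hv⟩
  · exact ⟨fun v w => φ w / φ v, fun v w => perronScheme_nonneg hpos v w,
      fun v w => perronScheme_reciprocal hpos v w,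
      fun v => perronScheme_charge_eq R hpos heig v⟩

end Summit.HubbardSuperconductivity.HubbardSuperconductivity.Theorems.ChargePerron
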